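import Summits.AtomisticToContinuum.HydrodynamicLimit.Theses.LindebergRandomFuture
import Summits.AtomisticToContinuum.HydrodynamicLimit.Theorems.LambertianContactSwapLambertianEulerOfHearts
import Summits.AtomisticToContinuum.HydrodynamicLimit.Theses.LambertianContactSwap
import Summits.AtomisticToContinuum.HydrodynamicLimit.Theorems.LambertianContactSwapLambertianEulerArchimedes
import Summits.AtomisticToContinuum.HydrodynamicLimit.Theorems.LambertianContactSwapLambertianEulerLambertLaw
import Summits.AtomisticToContinuum.HydrodynamicLimit.Theorems.LambertianContactSwapLambertianEulerPovzner
import Summits.AtomisticToContinuum.HydrodynamicLimit.Theorems.LambertianContactSwapLambertianEulerPairPovzner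
import Summits.AtomisticToContinuum.HydrodynamicLimit.Theorems.LambertianContactSwapLambertianEulerContactIsotropy
import Summits.AtomisticToContinuum.HydrodynamicLimit.Theorems.LambertianContactSwapLambertianEulerMomentLedgerChain
import Summits.AtomisticToContinuum.HydrodynamicLimit.Theorems.LambertianContactSwapLambertianEulerGibbsInvariance
import Summits.AtomisticToContinuum.HydrodynamicLimit.Theorems.LambertianContactSwapLambertianEulerEntropyToHydro
import Summits.AtomisticToContinuum.HydrodynamicLimit.Theorems.LambertianContactSwapLambertianEulerWindow
import Summits.AtomisticToContinuum.HydrodynamicLimit.Theorems.LambertianContactSwapLambertianEulerMarkov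
import Summits.AtomisticToContinuum.HydrodynamicLimit.Theorems.LambertianContactSwapLambertianEulerIterate
import Summits.AtomisticToContinuum.HydrodynamicLimit.Theorems.LambertianContactSwapLambertianEulerDock
import Summits.AtomisticToContinuum.HydrodynamicLimit.Theorems.LambertianContactSwapLambertianEulerKlLedger
import Summits.AtomisticToContinuum.HydrodynamicLimit.Theorems.LambertianContactSwapLambertianEulerLawSemigroup
import Summits.AtomisticToContinuum.HydrodynamicLimit.Theorems.LambertianContactSwapLambertianEulerDockRf
import Summits.AtomisticToContinuum.HydrodynamicLimit.Theorems.LambertianContactSwapLambertianEulerLambertDirMean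
import Summits.AtomisticToContinuum.HydrodynamicLimit.Theorems.LambertianContactSwapLambertianEulerPairMeanSq
import Summits.AtomisticToContinuum.HydrodynamicLimit.Theorems.LambertianContactSwapLambertianEulerPathwiseProduction
import Summits.AtomisticToContinuum.HydrodynamicLimit.Theorems.LambertianContactSwapLambertianEulerWindowLedger
import Summits.AtomisticToContinuum.HydrodynamicLimit.Theorems.LambertianContactSwapLambertianEulerCollisionCompensator
import Summits.AtomisticToContinuum.HydrodynamicLimit.Theorems.LambertianContactSwapLambertianEulerCompensatedJump
import Summits.AtomisticToContinuum.HydrodynamicLimit.Theorems.LambertianContactSwapLambertianEulerAprioriEntropyBound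
import Summits.AtomisticToContinuum.HydrodynamicLimit.Theorems.LambertianContactSwapLambertianEulerCollisionIntensity
import Summits.AtomisticToContinuum.HydrodynamicLimit.Theorems.LambertianContactSwapLambertianEulerTwoTimeLaw
import Summits.AtomisticToContinuum.HydrodynamicLimit.Theorems.LambertianContactSwapLambertianEulerCollisionBudget
import Summits.AtomisticToContinuum.HydrodynamicLimit.Theorems.LambertianContactSwapLambertianEulerExpectedWindowProductionTools
import Summits.AtomisticToContinuum.HydrodynamicLimit.Theorems.LambertianContactSwapLambertianEulerExpectedWindowProduction
import Summits.AtomisticToContinuum.HydrodynamicLimit.Theorems.LambertianContactSwapLambertianEulerProductionSplit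
import Summits.AtomisticToContinuum.HydrodynamicLimit.Theorems.TwoClocksClampedEntropyClockTimeZeroReference
import Summits.AtomisticToContinuum.HydrodynamicLimit.Theorems.TwoClocksClampedEntropyClockDiscreteEntropyGronwall
import Summits.AtomisticToContinuum.HydrodynamicLimit.Theorems.TwoClocksClampedEntropyClockKlDivLawAtLocalGibbsNeTop
import Literature.MathematicalPhysics.KineticTheory.LambertianRedrawNondegenerate
import Literature.MathematicalPhysics.KineticTheory.Hilbert6Wave0Proofs
import Literature.MathematicalPhysics.KineticTheory.HardSphereEulerLLN
import Literature.Barriers.AtomisticToContinuum.HighMomentumCutoff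
import Literature.Analysis.FluidPDE.HardSphereAlexander
import HarnessLib

/-! TTRL-lite variant V13060 of stmt-AtomisticToContinuum-11854 -/

namespace Summit.AtomisticToContinuum.HydrodynamicLimit.Theorems

open scoped BigOperators Topology ENNReal InnerProductSpace
open MeasureTheory ProbabilityTheory Filter Set InformationTheory
open Literature.MathematicalPhysics.KineticTheory
open Literature.Analysis.FluidPDE Literature.Analysis.FluidPDE.Alexander
open Summit.AtomisticToContinuum.HydrodynamicLimit.Theses.LambertianContactSwap
open Summit.AtomisticToContinuum.HydrodynamicLimit.Theorems.ClampedCurrentsDockPathwise (gSum DgSum)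

/-- **Uniform sup bound on the limit density.** Under `SmallDensity P σ` the cluster-expansion
density `rhoLim P σ x = ∑_j γ_{j+1} R^{j+1} β(x)^{j+1}` is dominated termwise by the geometric
majorant `2eM θʲ` (`SmallDensity.abs_rhoLim_term_le`, `θ = geomRatio P σ < 1`), whence
`|rhoLim| ≤ 2eM/(1-θ) = 2eM + 2M·(eθ/(1-θ)) < 2eM + M` by `phi_lt_half` (`eθ/(1-θ) < 1/2`):
`rhoLim P σ x < (2e+1)·M`, uniformly in `σ`.
TTRL-lite variant V13060 of `stub_diluteSelfConsistency` (stmt-AtomisticToContinuum-11854). -/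
theorem stub_diluteSelfConsistency_var13060 :
    ∀ (P : DensityProfile) (σ : ℝ), SmallDensity P σ → ∀ x : T3, rhoLim P σ x < (2 * Real.exp 1 + 1) * P.M := by
  intro P σ h x
  have hgeo : HasSum (fun j : ℕ => 2 * Real.exp 1 * P.M * geomRatio P σ ^ j)
      (2 * Real.exp 1 * P.M / (1 - geomRatio P σ)) := by
    rw [div_eq_mul_inv]
    exact (hasSum_geometric_of_lt_one h.geomRatio_nonneg h.geomRatio_lt_one).mul_left _
  have h1 : |rhoLim P σ x| ≤ 2 * Real.exp 1 * P.M / (1 - geomRatio P σ) :=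
    (Real.norm_eq_abs _).symm.trans_le
      (tsum_of_norm_bounded hgeo fun j => (Real.norm_eq_abs _).trans_le (h.abs_rhoLim_term_le j x))
  have hθ1 := h.geomRatio_lt_one
  have hφ := h.phi_lt_half
  have hM := P.M_pos
  have hne : (1 - geomRatio P σ) ≠ 0 := (sub_pos.2 hθ1).ne'
  have hkey : 2 * Real.exp 1 * P.M / (1 - geomRatio P σ) =
      2 * Real.exp 1 * P.M + 2 * P.M * (Real.exp 1 * geomRatio P σ / (1 - geomRatio P σ)) := by
    field_simp
    ring
  have h2 : 2 * Real.exp 1 * P.M / (1 - geomRatio P σ) < (2 * Real.exp 1 + 1) * P.M := by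
    rw [hkey]; nlinarith
  exact (le_abs_self _).trans_lt (h1.trans_lt h2)

end Summit.AtomisticToContinuum.HydrodynamicLimit.Theorems
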